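import Summits.QuantumFields.Balaban3D.Proofs.Bound55Std

/-!
# `Summit.QuantumFields.Balaban3D.Proofs.FibreClash` — the booked residual pair {R3D-01 `Fibre49` at the TRIVIAL new history,
# R3D-02 `Fibre57Low`} of ONE step `k` forces a Haar-NULL EVENT on the scale-`k` fields (seat p4 FINDING, lane `pub-balaban3d`)

HONEST FRAMING (lane PLAN.md §0, binding): see `…Proofs.SectAFirstStep`.  Nothing of [Balaban1985UV3] is asserted; this file is
[folklore] measure theory ABOUT the lane's two booked (β) residuals (`…Proofs.Bound55Std.Fibre49` / `Fibre57Low`, ruling R-FIBRE) at the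
lane's standard tower, recording a CONSISTENCY CONSTRAINT between them.

THE OBSERVATION.  At the trivial new history `triv_{k+1}` the step weight and the old mass are `1` (seat p1's `stepWeight_triv`,
`massRec_triv`), the transport of `1` is `1` dV-a.e. (Haar compatibility E6′), and the `Z`-term / remainder constants cancel
(`StepPieces.proj_triv`), so the two residuals read, dV-a.e. and with the SAME exponent
`F(V) = −(1/g_k²)A^η(U_{k+1}(V)) − E_k + (log σ₀ + d(𝔤) log g_k)|T*| + log Z + Σ𝒫_old + log Fl` (both leaves `Bound55`/`Bound55Lower` of
LQB read ONE fluctuation datum `P.logFl triv`):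
  R3D-01(triv):  `T_k[χB(triv) · G](V) ≤ e^{F(V)}`,      R3D-02:  `χ_{k+1}(V) · e^{F(V)} ≤ T_k[χ_k · G](V)`,
with `G = exp[−(1/g_k²)A^η(U_k(·)) + Σ𝒫]  > 0`, `χB(triv) = 𝟙{|U(∂p) − 1| < εS_k ∀p}` (`εS_k = 2L²g_{k−1}p(g_{k−1})`, the threshold seat p4
gave the small-field factor «χ» of (49) inside `B(Λ_{k+1})`) and `χ_k = 𝟙{|U(∂p) − 1| < ε₁(k) ∀p}` (`ε₁(k) = g_kp(g_k)`, the (4)/(47)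
function of the lane's run).  Since `ε₁(k) ≤ εS_k` (seat p3's `eps1Of_le_epsSOf`, the `hLS` of C1), `χ_k ≤ χB(triv)` pointwise, and the
two inequalities squeeze: integrating against the test function `χ_{k+1}` through the push-forward identity of `T_k` gives
`∫ (χB(triv) − χ_k)(U) · G(U) · χ_{k+1}(Ū) dU ≤ 0` with a non-negative integrand.  HENCE (`ae_small_of_transported_pair`):
  for dU-a.e. `U`:  |U(∂p) − 1| < εS_k ∀p  ∧  |Ū(∂p′) − 1| < ε₁(k+1) ∀p′   ⟹   |U(∂p) − 1| < ε₁(k) ∀p.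
For a non-trivial compact gauge group with full-support Haar measure (every `GroupModel`: SU(2), …) and non-degenerate thresholds
`0 < ε₁(k) < εS_k`, `0 < ε₁(k+1)` this event has POSITIVE measure for the lane's standard (axial) averaging (a configuration equal to `1`
except on one bond off every averaging line, with `ε₁(k) < |U(b) − 1| < εS_k`, and a Haar-open neighbourhood of it) — so the residual pair,
AS TYPED with `χB` at threshold `εS`, is JOINTLY UNSATISFIABLE at every step, for ANY data `(X.UkH, 𝔖)`: the END theorem's hypothesis list
would be contradictory (vacuity).  REPAIR (seat p4, same session): the «χ» of (49) is the decomposition-of-unity factor of step `k`, whose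
threshold print fixes as «ε₁ = g_kp(g_k)» (p. 267 L36–37 «We introduce the decomposition of unity (7) for the field V on the domain Λ_k, with
ε₁ = g_kp(g_k)»), i.e. `εL_k = eps1Of`, NOT `εS_k`: with `χB` at `eps1Of`, `χB(triv) = χ_k` and the squeeze becomes the (consistent) pinning
`T_k[χ_k G] = e^{F}` on `{χ_{k+1} = 1}` — `Bound55Std` v4 / `Bound55Masses` v5 carry the corrected threshold (the covering lemma `hcover` is
unaffected: off «the» large-field set the field is `< εL_k` by definition).
-/

noncomputable section

namespace Summit.QuantumFields.Balaban3D.Proofs.FibreClash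

open _root_.MeasureTheory
open Literature.MathematicalPhysics.QuantumFieldTheory.Balaban1983to89
open Literature.MathematicalPhysics.QuantumFieldTheory.Balaban1983to89.AveragingRT (rnTransport rnTransport_nonneg)
open Literature.MathematicalPhysics.QuantumFieldTheory.Balaban1983to89.B10SectAGathering (StepPieces)
open Literature.MathematicalPhysics.QuantumFieldTheory.Balaban1985CMP102
open Literature.MathematicalPhysics.QuantumFieldTheory.Balaban1985CMP102.Setting
open Summit.QuantumFields.Balaban3D.Carriers
open Summit.QuantumFields.Balaban3D.Proofs.Bound55Masses
open Summit.QuantumFields.Balaban3D.Proofs.Bound55Std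

variable {L : ℕ} {S : Scales L} {G : Type} [GaugeGroup G] [MeasurableSpace G] [HaarData G] [RegularGaugeGroup G]
  {V : Type} [NormedAddCommGroup V] [NormedSpace ℂ V]
  (X : ExternalInputs S G) (K : CarrierConsts) (𝔖 : ∀ k, StepSeries S G V (nblkOf S K k) k) (slot : ℕ → Prop) (k : ℕ)

omit [RegularGaugeGroup G] in
open Classical in
/-- The run's small-field function `χ_j` of (4)/(47) at the standard tower, unfolded: the indicator of `|U(∂p) − 1| < ε₁(j) = g_jp(g_j)` for
all plaquettes. [cite: Balaban1985UV3, (4) p.256] -/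
theorem chi_eq (j : ℕ) (U : GaugeField S.P j G) :
    ((stdTowerInput X K 𝔖).towerWith slot).chi j U = if PlaqSmall (eps1Of S K j) U then 1 else 0 := by
  show chiSmall Set.univ (eps1Of S K j) U = _
  have h : PlaqSmallOn Set.univ (eps1Of S K j) U ↔ PlaqSmall (eps1Of S K j) U :=
    ⟨fun H p => H p (Set.mem_univ p), fun H p _ => H p⟩
  unfold chiSmall
  by_cases hs : PlaqSmall (eps1Of S K j) U
  · rw [if_pos (h.mpr hs), if_pos hs]
  · rw [if_neg (fun H => hs (h.mp H)), if_neg hs]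

omit [MeasurableSpace G] [HaarData G] [RegularGaugeGroup G] in
open Classical in
/-- Seat p4's small-field factor `χB` of (49) at the TRIVIAL new history, unfolded: no large-field plaquettes and `Ω_{k+1}(triv) = T` (seat p1's
`Omega_triv`), so it is the indicator of `|U(∂p) − 1| < ε` for ALL plaquettes. [cite: Balaban1985UV3, (49) p.268] -/
theorem chiB_triv_eq (M₁ : ℕ) (Rcol : ℕ → ℕ) (ε : ℕ → ℝ) (U : GaugeField S.P k G) :
    chiB M₁ Rcol ε k (Hist.triv S.P (k + 1)) U = if PlaqSmall (ε k) U then 1 else 0 := by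
  unfold chiB
  split_ifs with H hs hs
  · rfl
  · exact absurd (fun p => H p (by rw [Hist.last_triv]; exact Finset.notMem_empty p) (by rw [Omega_triv]; exact Set.subset_univ _)) hs
  · exact absurd (fun p _ _ => hs p) H
  · rfl

/-- **THE CLASH LEMMA** (threshold-parametric).  At the lane's standard tower, step `k ≤ m+K`, let `ε'` be the threshold of the small-field
factor `χB` used in the transported (49)-inequality at the TRIVIAL new history (`h49`: literally the text of `Bound55Std.Fibre49 … (Hist.triv _)`
with `chiB` at `ε'` — seat p4's v1–v3 had `ε' := epsSOf S K`, v4 has `ε' := eps1Of S K`, see `fibre49_triv_iff`), with `ε₁(k) ≤ ε' k`, and assume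
the primitive regularity of the trivial-history data (`U_k(·, triv)` measurable, `Σ𝒫(triv)` measurable and bounded above — the inputs of
`hint47_std`).  IF `h49` AND the residual R3D-02 `Fibre57Low` (same pieces `P`) hold, THEN for dU_k-a.e. `U`: «all plaquettes `ε' k`-small and all
plaquettes of `Ū` `ε₁(k+1)`-small» implies «all plaquettes `ε₁(k)`-small».  For `ε' = ε₁` (v4) this is empty; for `ε' = εS > ε₁` (v3) and a gauge
group with full-support Haar measure the contrary event has positive measure (module docstring), so the v3 pair could not both hold. [folklore] -/
theorem ae_small_of_transported_pair (P : StepPieces ((stdTowerInput X K 𝔖).towerWith slot).toTowerRun k)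
    (ε' : ℕ → ℝ) (hk : k ≤ S.P.m + S.P.K) (hLS : eps1Of S K k ≤ ε' k)
    (hU : Measurable ((stdTowerInput X K 𝔖).UkH k (Hist.triv S.P k)))
    (hPm : Measurable ((stdTowerInput X K 𝔖).Pint k (Hist.triv S.P k))) (cP : ℝ)
    (hPb : ∀ U : GaugeField S.P k G, (stdTowerInput X K 𝔖).Pint k (Hist.triv S.P k) U ≤ cP)
    (h49 : (rnTransport (X.av k).avg (fun U =>
      stepWeight K.M₁ (rcolOf S K) (eps1Of S K) (epsSOf S K) k (Hist.triv S.P (k + 1)) U *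
        chiB K.M₁ (rcolOf S K) ε' k (Hist.triv S.P (k + 1)) U *
        ((stdTowerInput X K 𝔖).W.mass k (Hist.triv S.P (k + 1)).proj U *
          Real.exp (-(((stdTowerInput X K 𝔖).towerWith slot).mainT k (Hist.triv S.P (k + 1)).proj U)
            + (stdTowerInput X K 𝔖).Pint k (Hist.triv S.P (k + 1)).proj U
            - ((stdTowerInput X K 𝔖).towerWith slot).Ecst k
            + ((stdTowerInput X K 𝔖).towerWith slot).Zterm k (Hist.triv S.P (k + 1)).proj
            + ((stdTowerInput X K 𝔖).towerWith slot).Rm k))))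
      ≤ᵐ[fieldMeasure S.P (k + 1) G] fun V =>
        rnTransport (X.av k).avg (fun U =>
          stepWeight K.M₁ (rcolOf S K) (eps1Of S K) (epsSOf S K) k (Hist.triv S.P (k + 1)) U *
            (stdTowerInput X K 𝔖).W.mass k (Hist.triv S.P (k + 1)).proj U) V *
        Real.exp (-(((stdTowerInput X K 𝔖).towerWith slot).mainT (k + 1) (Hist.triv S.P (k + 1)) V)
          - ((stdTowerInput X K 𝔖).towerWith slot).Ecst k
          + (P.logσ₀ + P.dg * Real.log (S.gk k)) * P.starB (Hist.triv S.P (k + 1)) + P.logZU (Hist.triv S.P (k + 1)) V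
          + P.Pold (Hist.triv S.P (k + 1)) V
          + ((stdTowerInput X K 𝔖).towerWith slot).Zterm k (P.proj (Hist.triv S.P (k + 1)))
          + ((stdTowerInput X K 𝔖).towerWith slot).Rm k + P.logFl (Hist.triv S.P (k + 1)) V))
    (h57 : Fibre57Low X K 𝔖 slot k P) :
    ∀ᵐ U ∂(fieldMeasure S.P k G), PlaqSmall (ε' k) U →
      PlaqSmall (eps1Of S K (k + 1)) ((X.av k).avg U) → PlaqSmall (eps1Of S K k) U := by
  classical
  -- (no abbreviation for the tower / the averaging: their occurrences live in the types of `P`, `h49`, `h57`)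
  have havm : Measurable (X.av k).avg := X.av_meas k
  have hmap : (fieldMeasure S.P k G).map (X.av k).avg = fieldMeasure S.P (k + 1) G := X.av_map k
  have hAC : AvgAC (X.av k).avg := X.avgAC k
  -- the common core `g(U) = exp[−mainT_k(triv) + Pint_k(triv)]` and the constants
  set e₃ : GaugeField S.P k G → ℝ := fun U => -(((stdTowerInput X K 𝔖).towerWith slot).mainT k (Hist.triv S.P k) U) + (stdTowerInput X K 𝔖).Pint k (Hist.triv S.P k) U
      - ((stdTowerInput X K 𝔖).towerWith slot).Ecst k - ((stdTowerInput X K 𝔖).towerWith slot).Rm k with he₃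
  set δ : ℝ := ((stdTowerInput X K 𝔖).towerWith slot).Zterm k (Hist.triv S.P k) + 2 * ((stdTowerInput X K 𝔖).towerWith slot).Rm k with hδ
  set χB : GaugeField S.P k G → ℝ := chiB K.M₁ (rcolOf S K) ε' k (Hist.triv S.P (k + 1)) with hχB
  set F₁ : GaugeField S.P k G → ℝ := fun U => χB U * Real.exp (e₃ U + δ) with hF₁
  set F₃ : GaugeField S.P k G → ℝ := fun U => ((stdTowerInput X K 𝔖).towerWith slot).chi k U * Real.exp (e₃ U) with hF₃
  set f : GaugeField S.P (k + 1) G → ℝ := ((stdTowerInput X K 𝔖).towerWith slot).chi (k + 1) with hf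
  set E₄ : GaugeField S.P (k + 1) G → ℝ := fun W => -(((stdTowerInput X K 𝔖).towerWith slot).mainT (k + 1) (Hist.triv S.P (k + 1)) W) - ((stdTowerInput X K 𝔖).towerWith slot).Ecst k
      + (P.logσ₀ + P.dg * Real.log (S.gk k)) * P.starB (Hist.triv S.P (k + 1)) + P.logZU (Hist.triv S.P (k + 1)) W
      + P.Pold (Hist.triv S.P (k + 1)) W - ((stdTowerInput X K 𝔖).towerWith slot).Rm k + P.logFl (Hist.triv S.P (k + 1)) W with hE₄
  -- (i) the integrands of the two residuals at the trivial history, simplified pointwise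
  have hw1 : ∀ U : GaugeField S.P k G, stepWeight K.M₁ (rcolOf S K) (eps1Of S K) (epsSOf S K) k (Hist.triv S.P (k + 1)) U = 1 :=
    fun U => stepWeight_triv K.M₁ (rcolOf S K) (eps1Of S K) (epsSOf S K) hk U
  have hm1 : ∀ U : GaugeField S.P k G, (stdTowerInput X K 𝔖).W.mass k (Hist.triv S.P (k + 1)).proj U = 1 := fun U => by
    rw [Hist.proj_triv]; exact stdTowerInput_mass_triv X K 𝔖 k U
  have hPproj : P.proj (Hist.triv S.P (k + 1)) = Hist.triv S.P k := P.proj_triv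
  have hL49 : (fun U => stepWeight K.M₁ (rcolOf S K) (eps1Of S K) (epsSOf S K) k (Hist.triv S.P (k + 1)) U * χB U *
      ((stdTowerInput X K 𝔖).W.mass k (Hist.triv S.P (k + 1)).proj U *
        Real.exp (-(((stdTowerInput X K 𝔖).towerWith slot).mainT k (Hist.triv S.P (k + 1)).proj U) + (stdTowerInput X K 𝔖).Pint k (Hist.triv S.P (k + 1)).proj U
          - ((stdTowerInput X K 𝔖).towerWith slot).Ecst k + ((stdTowerInput X K 𝔖).towerWith slot).Zterm k (Hist.triv S.P (k + 1)).proj + ((stdTowerInput X K 𝔖).towerWith slot).Rm k))) = F₁ := by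
    funext U
    rw [hw1 U, hm1 U, one_mul, one_mul, hF₁]
    simp only [Hist.proj_triv]
    congr 1
    rw [he₃, hδ]; ring_nf
  have hR49 : (fun U => stepWeight K.M₁ (rcolOf S K) (eps1Of S K) (epsSOf S K) k (Hist.triv S.P (k + 1)) U *
      (stdTowerInput X K 𝔖).W.mass k (Hist.triv S.P (k + 1)).proj U) = fun _ => (1 : ℝ) := by
    funext U; rw [hw1 U, hm1 U, one_mul]
  -- (ii) the two residuals, rewritten
  have h49' : ∀ᵐ W ∂(fieldMeasure S.P (k + 1) G), rnTransport (X.av k).avg F₁ W ≤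
      rnTransport (X.av k).avg (fun _ => (1 : ℝ)) W * Real.exp (E₄ W + δ) := by
    have h := h49
    rw [hL49, hR49] at h
    filter_upwards [h] with W hW
    refine hW.trans_eq ?_
    congr 1
    simp only [hE₄, hδ, hPproj]; ring_nf
  have h57' : ∀ᵐ W ∂(fieldMeasure S.P (k + 1) G), f W * Real.exp (E₄ W) ≤ rnTransport (X.av k).avg F₃ W := by
    have h := h57
    unfold Fibre57Low at h
    filter_upwards [h] with W hW
    exact hW
  -- (iii) `T 1 = 1` a.e.
  have hone : rnTransport (X.av k).avg (fun _ => (1 : ℝ)) =ᵐ[fieldMeasure S.P (k + 1) G] fun _ => (1 : ℝ) :=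
    RTAlgebra.IsRT.ae_eq (isRT_rnTransport_of_ac hAC _ (integrable_const _)) (Transport48.isRT_one_of_map havm hmap) havm
      (integrable_const _) (integrable_rnTransport (X.av k).avg _ (integrable_const _)) (integrable_const _)
  -- (iv) integrability of the two integrands
  have hmain : ∀ U, ((stdTowerInput X K 𝔖).towerWith slot).mainT k (Hist.triv S.P k) U = (S.gk k)⁻¹ ^ 2 * S.actionEta k ((stdTowerInput X K 𝔖).UkH k (Hist.triv S.P k) U) :=
    fun _ => rfl
  have he₃m : Measurable e₃ := by
    rw [he₃]; simp_rw [hmain]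
    exact (((measurable_const.mul ((measurable_actionEta (S := S) k).comp hU)).neg.add hPm).sub measurable_const).sub
      measurable_const
  have he₃b : ∀ U, e₃ U ≤ cP - ((stdTowerInput X K 𝔖).towerWith slot).Ecst k - ((stdTowerInput X K 𝔖).towerWith slot).Rm k := fun U => by
    have h0 : 0 ≤ ((stdTowerInput X K 𝔖).towerWith slot).mainT k (Hist.triv S.P k) U := by
      rw [hmain]; exact mul_nonneg (sq_nonneg _) (actionEta_nonneg (S := S) k _)
    have h1 := hPb U
    rw [he₃]; linarith
  have hF₃i : Integrable F₃ (fieldMeasure S.P k G) := by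
    have hchi : ((stdTowerInput X K 𝔖).towerWith slot).chi k = chiSmall Set.univ ((stdTowerInput X K 𝔖).ε₁ k) := rfl
    refine Transport48.integrable_weight_mul_exp ?_ ?_ ?_ he₃m (c := cP - ((stdTowerInput X K 𝔖).towerWith slot).Ecst k - ((stdTowerInput X K 𝔖).towerWith slot).Rm k) he₃b
    · rw [hchi]; exact T4AxialGaugeFixing.measurable_chiSmall _ _
    · intro U; rw [hchi]; unfold chiSmall; split_ifs <;> norm_num
    · intro U; rw [hchi]; unfold chiSmall; split_ifs <;> norm_num
  have hF₁i : Integrable F₁ (fieldMeasure S.P k G) :=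
    Transport48.integrable_weight_mul_exp (measurable_chiB K.M₁ (rcolOf S K) ε' k _)
      (chiB_nonneg K.M₁ (rcolOf S K) ε' k _) (chiB_le_one K.M₁ (rcolOf S K) ε' k _)
      (he₃m.add measurable_const) (c := cP - ((stdTowerInput X K 𝔖).towerWith slot).Ecst k - ((stdTowerInput X K 𝔖).towerWith slot).Rm k + δ) (fun U => by have := he₃b U; linarith)
  -- (v) the test function `χ_{k+1}`: measurable, {0,1}-valued
  have hchi1 : ((stdTowerInput X K 𝔖).towerWith slot).chi (k + 1) = chiSmall Set.univ ((stdTowerInput X K 𝔖).ε₁ (k + 1)) := rfl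
  have hfm : Measurable f := by rw [hf, hchi1]; exact T4AxialGaugeFixing.measurable_chiSmall _ _
  have hf01 : ∀ W, f W = 0 ∨ f W = 1 := fun W => by
    rw [hf, hchi1]; unfold chiSmall; split_ifs <;> simp
  have hfC : ∃ C : ℝ, ∀ W, |f W| ≤ C := ⟨1, fun W => by rcases hf01 W with h | h <;> simp [h]⟩
  have hf0 : ∀ W, 0 ≤ f W := fun W => by rcases hf01 W with h | h <;> simp [h]
  have hf1 : ∀ W, f W ≤ 1 := fun W => by rcases hf01 W with h | h <;> simp [h]
  -- (vi) the squeeze, a.e. on the coarse fields: `f · T F₁ ≤ e^δ · (T F₃ · f)`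
  have hsq : ∀ᵐ W ∂(fieldMeasure S.P (k + 1) G),
      rnTransport (X.av k).avg F₁ W * f W ≤ Real.exp δ * (rnTransport (X.av k).avg F₃ W * f W) := by
    filter_upwards [h49', h57', hone] with W h1 h2 h3
    rw [h3, one_mul] at h1
    rcases hf01 W with h0 | h1'
    · rw [h0]; simp
    · rw [h1', mul_one, mul_one]
      rw [h1', one_mul] at h2
      calc rnTransport (X.av k).avg F₁ W ≤ Real.exp (E₄ W + δ) := h1
        _ = Real.exp δ * Real.exp (E₄ W) := by rw [Real.exp_add, mul_comm]
        _ ≤ Real.exp δ * rnTransport (X.av k).avg F₃ W := mul_le_mul_of_nonneg_left h2 (Real.exp_pos _).le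
  -- (vii) integrate and push through `T` (the IsRT identity with test function `f`)
  have hI₁ : Integrable (fun W => rnTransport (X.av k).avg F₁ W * f W) (fieldMeasure S.P (k + 1) G) :=
    RTAlgebra.integrable_mul_test (integrable_rnTransport (X.av k).avg F₁ hF₁i) hfm (C := 1) (fun W => by
      rw [abs_of_nonneg (hf0 W)]; exact hf1 W)
  have hI₃ : Integrable (fun W => rnTransport (X.av k).avg F₃ W * f W) (fieldMeasure S.P (k + 1) G) :=
    RTAlgebra.integrable_mul_test (integrable_rnTransport (X.av k).avg F₃ hF₃i) hfm (C := 1) (fun W => by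
      rw [abs_of_nonneg (hf0 W)]; exact hf1 W)
  have hint_le : ∫ W, rnTransport (X.av k).avg F₁ W * f W ∂(fieldMeasure S.P (k + 1) G) ≤
      Real.exp δ * ∫ W, rnTransport (X.av k).avg F₃ W * f W ∂(fieldMeasure S.P (k + 1) G) := by
    rw [← integral_const_mul]
    exact integral_mono_ae hI₁ (hI₃.const_mul _) hsq
  have hRT₁ := isRT_rnTransport_of_ac hAC F₁ hF₁i f hfm hfC
  have hRT₃ := isRT_rnTransport_of_ac hAC F₃ hF₃i f hfm hfC
  rw [hRT₁, hRT₃, ← integral_const_mul] at hint_le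
  -- (viii) the difference has a non-negative integrand with non-positive integral
  set D : GaugeField S.P k G → ℝ := fun U => (χB U - ((stdTowerInput X K 𝔖).towerWith slot).chi k U) * Real.exp (e₃ U + δ) * f ((X.av k).avg U) with hD
  have hχB01 : ∀ U, χB U = (if PlaqSmall (ε' k) U then 1 else 0) := fun U =>
    chiB_triv_eq (S := S) k K.M₁ (rcolOf S K) ε' U
  have hχk01 : ∀ U, ((stdTowerInput X K 𝔖).towerWith slot).chi k U = (if PlaqSmall (eps1Of S K k) U then 1 else 0) := fun U => chi_eq X K 𝔖 slot k U
  have hmono : ∀ U, ((stdTowerInput X K 𝔖).towerWith slot).chi k U ≤ χB U := fun U => by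
    rw [hχB01, hχk01]
    by_cases hs : PlaqSmall (eps1Of S K k) U
    · have hs' : PlaqSmall (ε' k) U := fun p => lt_of_lt_of_le (hs p) hLS
      rw [if_pos hs, if_pos hs']
    · rw [if_neg hs]; split_ifs <;> norm_num
  have hD0 : ∀ U, 0 ≤ D U := fun U =>
    mul_nonneg (mul_nonneg (sub_nonneg.mpr (hmono U)) (Real.exp_pos _).le) (hf0 _)
  have hIF₁ : Integrable (fun U => F₁ U * f ((X.av k).avg U)) (fieldMeasure S.P k G) :=
    RTAlgebra.integrable_mul_test_comp hF₁i havm hfm (C := 1) (fun W => by rw [abs_of_nonneg (hf0 W)]; exact hf1 W)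
  have hIF₃ : Integrable (fun U => F₃ U * f ((X.av k).avg U)) (fieldMeasure S.P k G) :=
    RTAlgebra.integrable_mul_test_comp hF₃i havm hfm (C := 1) (fun W => by rw [abs_of_nonneg (hf0 W)]; exact hf1 W)
  have hDi : Integrable D (fieldMeasure S.P k G) := by
    have : D = fun U => F₁ U * f ((X.av k).avg U) - Real.exp δ * (F₃ U * f ((X.av k).avg U)) := by
      funext U; rw [hD, hF₁, hF₃]; simp only; rw [Real.exp_add]; ring
    rw [this]; exact hIF₁.sub (hIF₃.const_mul _)
  have hDint : ∫ U, D U ∂(fieldMeasure S.P k G) ≤ 0 := by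
    have : ∫ U, D U ∂(fieldMeasure S.P k G) = ∫ U, F₁ U * f ((X.av k).avg U) ∂(fieldMeasure S.P k G)
        - ∫ U, Real.exp δ * (F₃ U * f ((X.av k).avg U)) ∂(fieldMeasure S.P k G) := by
      rw [← integral_sub hIF₁ (hIF₃.const_mul _)]
      refine integral_congr_ae (Filter.Eventually.of_forall fun U => ?_)
      rw [hD, hF₁, hF₃]; simp only; rw [Real.exp_add]; ring
    rw [this]; linarith
  have hDae : D =ᵐ[fieldMeasure S.P k G] 0 :=
    (integral_eq_zero_iff_of_nonneg_ae (Filter.Eventually.of_forall hD0) hDi).mp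
      (le_antisymm hDint (integral_nonneg hD0))
  -- (ix) read off the a.e. implication
  filter_upwards [hDae] with U hU hS hS1
  have hfU : f ((X.av k).avg U) = 1 := by
    rw [hf, hchi1]; unfold chiSmall PlaqSmallOn
    rw [if_pos]; intro p _; exact hS1 p
  have hχBU : χB U = 1 := by rw [hχB01, if_pos hS]
  by_contra hns
  have hχkU : ((stdTowerInput X K 𝔖).towerWith slot).chi k U = 0 := by rw [hχk01, if_neg hns]
  have : D U = Real.exp (e₃ U + δ) := by rw [hD]; simp only; rw [hχBU, hχkU, hfU]; ring
  rw [this] at hU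
  exact absurd hU (Real.exp_pos _).ne'

omit [RegularGaugeGroup G] in
/-- SHAPE CERTIFICATE: the hypothesis `h49` of `ae_small_of_transported_pair` at `ε' := eps1Of S K` IS the residual R3D-01 `Fibre49` (v4) at the
trivial new history, definitionally. [folklore] -/
theorem fibre49_triv_iff (P : StepPieces ((stdTowerInput X K 𝔖).towerWith slot).toTowerRun k) :
    Fibre49 X K 𝔖 slot k P (Hist.triv S.P (k + 1)) ↔
    ((rnTransport (X.av k).avg (fun U =>
      stepWeight K.M₁ (rcolOf S K) (eps1Of S K) (epsSOf S K) k (Hist.triv S.P (k + 1)) U *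
        chiB K.M₁ (rcolOf S K) (eps1Of S K) k (Hist.triv S.P (k + 1)) U *
        ((stdTowerInput X K 𝔖).W.mass k (Hist.triv S.P (k + 1)).proj U *
          Real.exp (-(((stdTowerInput X K 𝔖).towerWith slot).mainT k (Hist.triv S.P (k + 1)).proj U)
            + (stdTowerInput X K 𝔖).Pint k (Hist.triv S.P (k + 1)).proj U
            - ((stdTowerInput X K 𝔖).towerWith slot).Ecst k
            + ((stdTowerInput X K 𝔖).towerWith slot).Zterm k (Hist.triv S.P (k + 1)).proj
            + ((stdTowerInput X K 𝔖).towerWith slot).Rm k))))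
      ≤ᵐ[fieldMeasure S.P (k + 1) G] fun V =>
        rnTransport (X.av k).avg (fun U =>
          stepWeight K.M₁ (rcolOf S K) (eps1Of S K) (epsSOf S K) k (Hist.triv S.P (k + 1)) U *
            (stdTowerInput X K 𝔖).W.mass k (Hist.triv S.P (k + 1)).proj U) V *
        Real.exp (-(((stdTowerInput X K 𝔖).towerWith slot).mainT (k + 1) (Hist.triv S.P (k + 1)) V)
          - ((stdTowerInput X K 𝔖).towerWith slot).Ecst k
          + (P.logσ₀ + P.dg * Real.log (S.gk k)) * P.starB (Hist.triv S.P (k + 1)) + P.logZU (Hist.triv S.P (k + 1)) V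
          + P.Pold (Hist.triv S.P (k + 1)) V
          + ((stdTowerInput X K 𝔖).towerWith slot).Zterm k (P.proj (Hist.triv S.P (k + 1)))
          + ((stdTowerInput X K 𝔖).towerWith slot).Rm k + P.logFl (Hist.triv S.P (k + 1)) V)) :=
  Iff.rfl

end Summit.QuantumFields.Balaban3D.Proofs.FibreClash

end
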